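import Literature.NumberTheory.NumberFields.NFIsoResultant
import Mathlib.Data.Nat.Choose.Basic
import HarnessLib

/-!
# The norm polynomial of Trager's method by exact integer interpolation (Cohen Alg. 3.6.4)

Support file for the discharge of the named fact
`Literature.NumberTheory.NumberFields.nfIso_mem_P` (number-field isomorphism is in `P`;
Landau 1985, A. K. Lenstra 1983 Thm. (3.7)). The isomorphism test needs the COEFFICIENTS of the
norm polynomial `N_c(X) = Res_Y(q(Y), p(X − cY)) ∈ ℤ[X]` (to factor it by [LLL82]); the machine
obtains them from the `deg p · deg q + 1` integer resultants `N_c(t)`, `t = 0, …, deg p · deg q`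
(`NFIsoResultant.resVal`, the tree's polynomial-time determinant) by Lagrange interpolation kept
inside `ℤ`: with `D = deg p · deg q`,

  `D! · N_c = Σ_{i ≤ D} N_c(i) · (−1)^{D−i} · binom(D, i) · ∏_{j ≤ D, j ≠ i} (X − j)`,

followed by the exact division by `D!` (exact because the symbolic resultant
`NFIsoResultant.normSym` is an integer polynomial of degree `≤ D` with these values). This file
writes that computation as a total functional program on coefficient lists and proves it:

* `lagNumer D i = ∏_{j ≠ i} (X − j)`, `lagScalar D i = (−1)^{D−i} binom(D, i)`, `interpMul`,
  `interp D v` (division by `D!`), `normPoly pl ql c m n`;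
* `prod_sub_eq` — `∏_{j ≤ D, j ≠ t} (t − j) = (−1)^{D−t} t! (D − t)!`, whence
  `eval_interpMul` (`(D! N)(t) = D! · v_t`);
* `ofCoeffs_interp` — **exactness**: if some `N₀ ∈ ℤ[X]` of degree `≤ D` takes the values `v_t`
  at `t = 0, …, D`, then `ofCoeffs (interp D v) = N₀`;
* **`ofCoeffs_normPoly`** / **`normPoly_spec`**: `ofCoeffs (normPoly pl ql c m n) = normSym p q c`
  (`p = ofCoeffs pl`, `q = ofCoeffs ql` of degrees `n`, `m`), so it has degree `≤ n · m` and the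
  values `Res_Y(q(Y), p(t − cY))` at `t = 0, …, n · m` — exactly the hypotheses `hNdeg`, `hNeval`
  of `Literature.Computability.Complexity.nfIsomorphic_iff_of_norm_values`.

## References

* H. Cohen, *A Course in Computational Algebraic Number Theory*, GTM 138, Springer 1993, §3.6.2,
  Alg. 3.6.4 (norm by a resultant), §3.3.2. [Cohen1993]
* S. Landau, *Factoring polynomials over algebraic number fields*, SIAM J. Comput. 14 (1985)
  184–195, §1 (Thm. 1.4). [Landau1985]
* D. E. Knuth, *The Art of Computer Programming*, Vol. 2, 3rd ed., §4.6.4 (interpolation: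
  Lagrange's formula). [KnuthTAOCP2]
-/

open Polynomial Finset

namespace Literature.NumberTheory.NumberFields

open Literature.Computability.Complexity Literature.Computability.Complexity.SumcheckMA
open scoped Nat

/-! ### The program -/

/-- The numerator `∏_{j ≤ D, j ≠ i} (X − j)` of the `i`-th Lagrange basis polynomial on the nodes
`0, …, D`, as a coefficient list. [cite: KnuthTAOCP2, §4.6.4 (Lagrange's interpolation formula)] -/
def lagNumer (D i : ℕ) : List ℤ :=
  pprod (((List.range (D + 1)).filter fun j => decide (j ≠ i)).map fun j : ℕ => [-(j : ℤ), 1])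

/-- The integer `D! / ∏_{j ≠ i} (i − j) = (−1)^{D−i} binom(D, i)`. [cite: KnuthTAOCP2, §4.6.4] -/
def lagScalar (D i : ℕ) : ℤ := (-1) ^ (D - i) * (D.choose i : ℤ)

/-- `D!` times the interpolating polynomial of the values `v₀, …, v_D` at `0, …, D`.
[cite: KnuthTAOCP2, §4.6.4] -/
def interpMul (D : ℕ) (v : List ℤ) : List ℤ :=
  psum ((List.range (D + 1)).map fun i => pscale (v.getD i 0 * lagScalar D i) (lagNumer D i))

/-- **The interpolating polynomial** of integer values known to come from an integer polynomial of
degree `≤ D`: `interpMul` divided exactly by `D!`. [cite: KnuthTAOCP2, §4.6.4] -/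
def interp (D : ℕ) (v : List ℤ) : List ℤ := (interpMul D v).map fun x => x / (D ! : ℤ)

/-- **The norm polynomial on coefficient lists** (Cohen Alg. 3.6.4 step 3, Landau Thm. 1.4): the
interpolation at `t = 0, …, n·m` of the integer resultants `Res_Y(q(Y), p(t − cY))` (`resVal`, formal
degrees `m = deg q`, `n = deg p`). [cite: Cohen1993, Alg. 3.6.4 step 3] [cite: Landau1985, §1 (Thm. 1.4)] -/
def normPoly (pl ql : List ℤ) (c : ℤ) (m n : ℕ) : List ℤ :=
  interp (n * m) ((List.range (n * m + 1)).map fun t : ℕ => resVal ql (pcompLin pl (t : ℤ) c) m n)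

/-! ### List sums and products over ranges as `Finset` sums and products -/

/-- `((List.range n).map g).sum = ∑_{i < n} g i`. [folklore] -/
theorem list_sum_range_map {M : Type*} [AddCommMonoid M] (g : ℕ → M) :
    ∀ n : ℕ, ((List.range n).map g).sum = ∑ i ∈ range n, g i
  | 0 => by simp
  | n + 1 => by
    rw [List.range_succ, List.map_append, List.sum_append, list_sum_range_map g n, sum_range_succ]
    simp

/-- The product over the filtered range as a `Finset` product. [folklore] -/
theorem list_prod_filter_range_map {M : Type*} [CommMonoid M] (g : ℕ → M) (n i : ℕ) :
    ((((List.range n).filter fun j => decide (j ≠ i)).map g).prod) =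
      ∏ j ∈ (range n).filter (fun j => j ≠ i), g j := by
  rw [← List.prod_toFinset _ (List.nodup_range.filter _), List.toFinset_filter, List.toFinset_range]
  congr 1
  ext j
  simp

/-! ### The Lagrange numerators -/

/-- `ofCoeffs (lagNumer D i) = ∏_{j ≤ D, j ≠ i} (X − j)`. [cite: KnuthTAOCP2, §4.6.4] -/
theorem ofCoeffs_lagNumer (D i : ℕ) :
    ofCoeffs (lagNumer D i) = ∏ j ∈ (range (D + 1)).filter (fun j => j ≠ i), (X - C (j : ℤ)) := by
  rw [lagNumer, ofCoeffs_pprod, List.map_map, ← list_prod_filter_range_map]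
  congr 1
  refine List.map_congr_left fun j _ => ?_
  show ofCoeffs [-(j : ℤ), 1] = X - C (j : ℤ)
  simp only [ofCoeffs, C_neg, map_one, mul_zero, add_zero, mul_one]
  ring

/-- The set of nodes other than `i ≤ D` has `D` elements. [folklore] -/
theorem card_filter_ne {D i : ℕ} (hi : i ≤ D) : ((range (D + 1)).filter (fun j => j ≠ i)).card = D := by
  rw [Finset.filter_ne', card_erase_of_mem (mem_range.2 (Nat.lt_succ_of_le hi)), card_range]
  rfl

/-- The numerators have degree `≤ D` (`i ≤ D`). [folklore] -/
theorem natDegree_lagNumer_le {D i : ℕ} (hi : i ≤ D) : (ofCoeffs (lagNumer D i)).natDegree ≤ D := by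
  rw [ofCoeffs_lagNumer]
  refine (natDegree_prod_le _ _).trans ?_
  refine (sum_le_sum fun (j : ℕ) _ => natDegree_X_sub_C_le (j : ℤ)).trans ?_
  rw [sum_const, smul_eq_mul, mul_one, card_filter_ne hi]

/-- At a node `t ≠ i` the `i`-th numerator vanishes. [cite: KnuthTAOCP2, §4.6.4] -/
theorem eval_lagNumer_of_ne {D i t : ℕ} (ht : t ≤ D) (hti : t ≠ i) :
    (ofCoeffs (lagNumer D i)).eval (t : ℤ) = 0 := by
  rw [ofCoeffs_lagNumer, eval_prod]
  exact prod_eq_zero (i := t) (mem_filter.2 ⟨mem_range.2 (Nat.lt_succ_of_le ht), hti⟩) (by simp)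

/-- `∏_{j < t} (t − j) = t!`. [folklore] -/
theorem prod_range_sub_eq_factorial (t : ℕ) : ∏ j ∈ range t, ((t : ℤ) - j) = (t ! : ℤ) := by
  rw [← prod_range_reflect (fun j => ((t : ℤ) - j)) t, ← prod_range_add_one_eq_factorial, Nat.cast_prod]
  refine prod_congr rfl fun j hj => ?_
  have := mem_range.1 hj
  push_cast
  omega

/-- `∏_{t < j ≤ D} (t − j) = (−1)^{D−t} (D − t)!`. [folklore] -/
theorem prod_Ioc_sub_eq (t D : ℕ) : ∏ j ∈ Ioc t D, ((t : ℤ) - j) = (-1) ^ (D - t) * ((D - t)! : ℤ) := by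
  have hI : Ioc t D = Ico (t + 1) (D + 1) := by
    ext j
    simp only [mem_Ioc, mem_Ico]
    omega
  rw [hI, prod_Ico_eq_prod_range, show D + 1 - (t + 1) = D - t by omega,
    ← prod_range_add_one_eq_factorial, Nat.cast_prod]
  have : ∀ k ∈ range (D - t), ((t : ℤ) - ((t + 1 + k : ℕ) : ℤ)) = (-1) * ((k + 1 : ℕ) : ℤ) := by
    intro k _
    push_cast
    ring
  rw [prod_congr rfl this, prod_mul_distrib, prod_const, card_range]

/-- **The denominators of Lagrange's formula on the nodes `0, …, D`**:
`∏_{j ≤ D, j ≠ t} (t − j) = (−1)^{D−t} · t! · (D − t)!`. [cite: KnuthTAOCP2, §4.6.4] -/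
theorem prod_sub_eq {D t : ℕ} (ht : t ≤ D) :
    ∏ j ∈ (range (D + 1)).filter (fun j => j ≠ t), ((t : ℤ) - j) =
      (-1) ^ (D - t) * ((t ! : ℤ) * ((D - t)! : ℤ)) := by
  have hsplit : (range (D + 1)).filter (fun j => j ≠ t) = range t ∪ Ioc t D := by
    ext j
    simp only [mem_filter, mem_range, mem_union, mem_Ioc]
    omega
  have hdisj : Disjoint (range t) (Ioc t D) := by
    rw [disjoint_left]
    intro j hj hj'
    rw [mem_range] at hj
    rw [mem_Ioc] at hj'
    omega
  rw [hsplit, prod_union hdisj, prod_range_sub_eq_factorial, prod_Ioc_sub_eq]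
  ring

/-- `lagScalar D t` times the `t`-th denominator is `D!`. [cite: KnuthTAOCP2, §4.6.4] -/
theorem lagScalar_mul_prod_sub {D t : ℕ} (ht : t ≤ D) :
    lagScalar D t * ∏ j ∈ (range (D + 1)).filter (fun j => j ≠ t), ((t : ℤ) - j) = (D ! : ℤ) := by
  rw [prod_sub_eq ht, lagScalar]
  have hch : ((D.choose t : ℕ) : ℤ) * ((t ! : ℤ) * ((D - t)! : ℤ)) = (D ! : ℤ) := by
    have := Nat.choose_mul_factorial_mul_factorial ht
    rw [← mul_assoc]
    exact_mod_cast this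
  have hsign : ((-1 : ℤ) ^ (D - t)) * (-1) ^ (D - t) = 1 := by
    rw [← mul_pow, neg_one_mul, neg_neg, one_pow]
  linear_combination (-1 : ℤ) ^ (D - t) * (-1) ^ (D - t) * hch + (D ! : ℤ) * hsign

/-- At its own node the `t`-th numerator evaluates to the `t`-th denominator. [folklore] -/
theorem eval_lagNumer_self (D t : ℕ) :
    (ofCoeffs (lagNumer D t)).eval (t : ℤ) = ∏ j ∈ (range (D + 1)).filter (fun j => j ≠ t), ((t : ℤ) - j) := by
  rw [ofCoeffs_lagNumer, eval_prod]
  exact prod_congr rfl fun j _ => by rw [eval_sub, eval_X, eval_C]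

/-! ### `D!` times the interpolant -/

/-- `ofCoeffs (interpMul D v)` as a `Finset` sum. [folklore] -/
theorem ofCoeffs_interpMul (D : ℕ) (v : List ℤ) :
    ofCoeffs (interpMul D v) =
      ∑ i ∈ range (D + 1), C (v.getD i 0 * lagScalar D i) * ofCoeffs (lagNumer D i) := by
  rw [interpMul, ofCoeffs_psum, List.map_map, ← list_sum_range_map]
  congr 1
  refine List.map_congr_left fun i _ => ?_
  simp only [Function.comp_apply, ofCoeffs_pscale]

/-- `deg (D! · N) ≤ D`. [folklore] -/
theorem natDegree_interpMul_le (D : ℕ) (v : List ℤ) : (ofCoeffs (interpMul D v)).natDegree ≤ D := by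
  rw [ofCoeffs_interpMul]
  exact natDegree_sum_le_of_forall_le _ _ fun i hi =>
    (natDegree_C_mul_le _ _).trans (natDegree_lagNumer_le (Nat.lt_succ_iff.1 (mem_range.1 hi)))

/-- **`(D! · N)(t) = D! · v_t` at every node `t ≤ D`.** [cite: KnuthTAOCP2, §4.6.4] -/
theorem eval_interpMul {D t : ℕ} (v : List ℤ) (ht : t ≤ D) :
    (ofCoeffs (interpMul D v)).eval (t : ℤ) = (D ! : ℤ) * v.getD t 0 := by
  rw [ofCoeffs_interpMul, eval_finsetSum,
    sum_eq_single t (fun i _ hit => ?_) (fun h => absurd (mem_range.2 (Nat.lt_succ_of_le ht)) h)]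
  · rw [eval_mul, eval_C, eval_lagNumer_self, mul_assoc, lagScalar_mul_prod_sub ht, mul_comm]
  · rw [eval_mul, eval_C, eval_lagNumer_of_ne ht (Ne.symm hit), mul_zero]

/-! ### Exactness of the division -/

/-- **The interpolation is exact**: if an integer polynomial `N₀` of degree `≤ D` takes the values
`v_t` at `t = 0, …, D`, then `D! · N = D! · N₀` (two polynomials of degree `≤ D` agreeing at `D + 1`
points) and `ofCoeffs (interp D v) = N₀`. [cite: KnuthTAOCP2, §4.6.4 (uniqueness of the interpolating polynomial)] -/
theorem ofCoeffs_interp {D : ℕ} {v : List ℤ} {N₀ : ℤ[X]} (hdeg : N₀.natDegree ≤ D)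
    (hval : ∀ t : ℕ, t ≤ D → N₀.eval (t : ℤ) = v.getD t 0) : ofCoeffs (interp D v) = N₀ := by
  have hfac : (D ! : ℤ) ≠ 0 := by exact_mod_cast (Nat.factorial_pos D).ne'
  -- `D! · N = D! · N₀`
  have hmul : ofCoeffs (interpMul D v) = C (D ! : ℤ) * N₀ := by
    let pts : Finset ℤ := (range (D + 1)).image fun k : ℕ => (k : ℤ)
    have hpts : pts.card = D + 1 := by
      simp only [pts]
      rw [card_image_of_injective _ Nat.cast_injective, card_range]
    apply eq_of_degrees_lt_of_eval_finset_eq pts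
    · rw [hpts]
      exact (degree_le_natDegree.trans (WithBot.coe_le_coe.2 (natDegree_interpMul_le D v))).trans_lt
        (WithBot.coe_lt_coe.2 (Nat.lt_succ_self D))
    · rw [hpts]
      refine (degree_le_natDegree.trans (WithBot.coe_le_coe.2 ?_)).trans_lt (WithBot.coe_lt_coe.2 (Nat.lt_succ_self D))
      exact (natDegree_C_mul_le _ _).trans hdeg
    · intro x hx
      obtain ⟨t, ht, rfl⟩ := mem_image.1 hx
      have htD : t ≤ D := Nat.lt_succ_iff.1 (mem_range.1 ht)
      rw [eval_interpMul v htD, eval_mul, eval_C, hval t htD]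
  -- coefficientwise division
  ext k
  have hk : (interpMul D v).getD k 0 = (D ! : ℤ) * N₀.coeff k := by
    rw [← coeff_ofCoeffs, hmul, coeff_C_mul]
  rw [coeff_ofCoeffs, interp, List.getD_eq_getElem?_getD, List.getElem?_map]
  by_cases hlt : k < (interpMul D v).length
  · rw [List.getElem?_eq_getElem hlt, Option.map_some, Option.getD_some]
    have : (interpMul D v)[k] = (D ! : ℤ) * N₀.coeff k := by
      rw [← hk, List.getD_eq_getElem _ _ hlt]
    rw [this, Int.mul_ediv_cancel_left _ hfac]
  · rw [List.getElem?_eq_none (not_lt.1 hlt), Option.map_none, Option.getD_none]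
    rw [List.getD_eq_default _ _ (not_lt.1 hlt)] at hk
    exact ((mul_eq_zero.1 hk.symm).resolve_left hfac).symm

/-! ### The norm polynomial -/

/-- **`normPoly` computes the symbolic norm**: for coefficient lists `pl`, `ql` of polynomials
`p`, `q` of degrees `n`, `m`, `ofCoeffs (normPoly pl ql c m n) = normSym p q c = Res_Y(q(Y), p(X − cY))`.
[cite: Cohen1993, Alg. 3.6.4 step 3] [cite: Landau1985, §1 (Thm. 1.4)] -/
theorem ofCoeffs_normPoly {pl ql : List ℤ} {m n : ℕ} (hm : (ofCoeffs ql).natDegree = m)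
    (hn : (ofCoeffs pl).natDegree = n) (c : ℤ) :
    ofCoeffs (normPoly pl ql c m n) = normSym (ofCoeffs pl) (ofCoeffs ql) c := by
  set p := ofCoeffs pl with hp
  set q := ofCoeffs ql with hq
  have hdeg : (normSym p q c).natDegree ≤ n * m := by
    have := natDegree_normSym_le p q c
    rw [hm, hn, mul_comm] at this
    exact this
  refine ofCoeffs_interp hdeg fun t ht => ?_
  rw [List.getD_eq_getElem?_getD, List.getElem?_map, List.getElem?_range (Nat.lt_succ_of_le ht), Option.map_some,
    Option.getD_some, resVal_eq, ofCoeffs_pcompLin, eval_normSym, hm, hn]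

/-- **Specification of `normPoly`** in the shape consumed by
`Literature.Computability.Complexity.nfIsomorphic_iff_of_norm_values`: degree `≤ n · m` and the
values `Res_Y(q(Y), p(t − cY))` (formal degrees `m`, `n`) at `t = 0, …, n · m`.
[cite: Cohen1993, Alg. 3.6.4 step 3] [cite: Landau1985, §1 (Thm. 1.4)] -/
theorem normPoly_spec {pl ql : List ℤ} {m n : ℕ} (hm : (ofCoeffs ql).natDegree = m)
    (hn : (ofCoeffs pl).natDegree = n) (c : ℤ) :
    (ofCoeffs (normPoly pl ql c m n)).natDegree ≤ n * m ∧
      ∀ t : ℕ, t ≤ n * m → (ofCoeffs (normPoly pl ql c m n)).eval (t : ℤ) =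
        resultant (ofCoeffs ql) ((ofCoeffs pl).comp (C (t : ℤ) - C c * X)) m n := by
  rw [ofCoeffs_normPoly hm hn]
  refine ⟨?_, fun t _ => ?_⟩
  · have := natDegree_normSym_le (ofCoeffs pl) (ofCoeffs ql) c
    rw [hm, hn, mul_comm] at this
    exact this
  · rw [eval_normSym, hm, hn]

end Literature.NumberTheory.NumberFields
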